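import Mathlib
import HarnessLib
import Summits.ResolutionOfSingularities.ResolutionOfSingularities.Theorems.WildQuotientsWildQuotientResolutionJordanFourHalfConeAway
import Summits.ResolutionOfSingularities.ResolutionOfSingularities.Theorems.WildQuotientsWildQuotientResolutionJordanFourTwistedVertexRadical
import Summits.ResolutionOfSingularities.ResolutionOfSingularities.Theorems.WildQuotientsWildQuotientResolutionJordanFourTwistedChart
import Summits.ResolutionOfSingularities.ResolutionOfSingularities.Theorems.WildQuotientsWildQuotientResolutionBlowupExitAwayFixed

/-!
# V4U brick `H₁`, algebra (3): the ring brick on the CHART MODEL — presentation of the invariants,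
# and the radical identity, for any ring `C` identified with the even chart model `E_Q ⊆ k[x][1/Q]`
(crux stmt-ResolutionOfSingularities-15640 `WildQuotients.WildQuotientResolution`, line `Sketch`;
chain w45c programme V4U, `L/w45c/CHAIN.md` v7.6 §4, brick `H₁` = lead-1
`JordanFour.coneBrick_T_of_ringBrick`'s hypothesis (p508076), ORDER res-L1-w45c-plan-1 RULING
v7.5a/CORRECTION 2026-08-27T06:30:44Z → res-type-036; [OURS · L1 W4.5c] — NOT a statement of any
manuscript; replaces the role of no printed item.)

PURE ALGEBRA, no schemes except `affineBlowup J₀`. Data: `L` a localisation of `k[x]` at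
`Q = JordanFour.twistedQ` (a domain), `τ_L : L →ₐ[k] L` extending the translation `τ = Σ_T`,
`E_Q = adjoin k (algebraMap '' evenGens ∪ {1/Q}) ⊆ L` (res-L1-w45c-stub-2's chart model of `Γ(W_T)`),
a ring `C` with a structure map `base : k[x] → C` and an identification `eE : C ≃+* E_Q` with
`eE (base F) = ψ_T F` (`ψ_T = JordanFour.twistedChart`; this is the CONCLUSION SHAPE of stub-2's T2(b)
`exists_chartT_ringEquiv`), and elements `t_j ∈ C` (`j ≠ 4`) with `base T′ · t_j = base g_j` (the
chart ratios). THEN (`exists_ringBrick_T_model`): there are `R₀` (the cone localised at `Q`: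
`Localization.Away Q ↥S_T`, `S_T = JordanFour.invSubalgebraT`), `J₀ ⊆ R₀` and an INJECTIVE
`ψC : R₀ → C` with
* `range ψC = {y | τ_L (eE y) = eE y}` (res-type-087 (G1c)/(G1d) `BlowupExitAway.*`, p505199, with
  `F₀ := S_T`, res-L1-w45c-stub-1 `coe_invSubalgebraT` p507494);
* `J₀` radical, `Bl_{J₀}` regular, and **`√(ψC⁻¹⟨base x_a, base x_b, base x_c, t_j⟩) = J₀`**
  (res-type-036 parts 1–2: `radical_span_twistedVertex_eq` p508119, `exists_halfConeVertexIdeal`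
  p509154; `IsLocalization.map_radical`; lying over along the INTEGRAL extension `E_Q ⊆ L`,
  `isIntegral_of_evenModel`).
The scheme brick `H₁` is this at `C := (R[I₆t])_{(T′t·H′³t²)}` through res-L1-w45c-stub-5's seam
(`…BlowupExitBasicOpenSections`) — file 4.
-/

-- single-problem summit: the doubled namespace component `ResolutionOfSingularities` is forced
set_option linter.dupNamespace false

noncomputable section

open MvPolynomial AlgebraicGeometry Literature.AlgebraicGeometry.Resolution

namespace Summit.ResolutionOfSingularities.ResolutionOfSingularities.Theorems.WildQuotientResolution.JordanFour

variable (k : Type) [Field k] (n : ℕ) (a b c d : Fin n)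

/-! ## `L = k[x][1/Q]` is integral over the even model `E_Q` -/

/-- **`L` is integral over `E_Q = k[algebraMap '' evenGens, 1/Q]`**: the odd variables `s, A, ξ` have
their squares in `E_Q`, the passengers and `1/Q` lie in `E_Q`. [OURS · L1 W4.5c] [folklore] -/
theorem isIntegral_of_evenModel {L : Type} [CommRing L] [Algebra k L]
    [Algebra (MvPolynomial (Fin n) k) L] [IsScalarTower k (MvPolynomial (Fin n) k) L]
    [IsLocalization.Away (twistedQ k n a b d) L] (x : L) :
    IsIntegral (Algebra.adjoin k (algebraMap (MvPolynomial (Fin n) k) L '' evenGens k n a b c ∪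
      {IsLocalization.Away.invSelf (S := L) (twistedQ k n a b d)})) x := by
  classical
  set E := Algebra.adjoin k (algebraMap (MvPolynomial (Fin n) k) L '' evenGens k n a b c ∪
      {IsLocalization.Away.invSelf (S := L) (twistedQ k n a b d)}) with hE
  have hmemE : ∀ {y : L} (hy : y ∈ E), IsIntegral E y := fun {y} hy =>
    (isIntegral_algebraMap (R := E) (A := L) (x := ⟨y, hy⟩))
  have hgen : ∀ g ∈ evenGens k n a b c, algebraMap (MvPolynomial (Fin n) k) L g ∈ E := fun g hg =>
    Algebra.subset_adjoin (Set.mem_union_left _ ⟨g, hg, rfl⟩)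
  -- every variable is integral over `E`
  have hX : ∀ i : Fin n, IsIntegral E (algebraMap (MvPolynomial (Fin n) k) L (X i)) := by
    intro i
    by_cases h : i = a ∨ i = b ∨ i = c
    · have hsq : (X i ^ 2 : MvPolynomial (Fin n) k) ∈ evenGens k n a b c := by
        rcases h with rfl | rfl | rfl <;> simp [evenGens]
      refine IsIntegral.of_pow two_pos ?_
      rw [← map_pow]
      exact hmemE (hgen _ hsq)
    · push Not at h
      have hi : (X i : MvPolynomial (Fin n) k) ∈ evenGens k n a b c :=
        Set.mem_union_right _ ⟨i, ⟨h.1, h.2.1, h.2.2⟩, rfl⟩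
      exact hmemE (hgen _ hi)
  have hpoly : ∀ f : MvPolynomial (Fin n) k, IsIntegral E (algebraMap (MvPolynomial (Fin n) k) L f) := by
    intro f
    induction f using MvPolynomial.induction_on with
    | C r =>
        have : algebraMap (MvPolynomial (Fin n) k) L (C r) = algebraMap k L r := by
          rw [← MvPolynomial.algebraMap_eq, ← IsScalarTower.algebraMap_apply]
        rw [this]
        exact hmemE (Subalgebra.algebraMap_mem E r)
    | add p q hp hq => rw [map_add]; exact hp.add hq
    | mul_X p i hp => rw [map_mul]; exact hp.mul (hX i)
  obtain ⟨m, f, hx⟩ := IsLocalization.Away.surj (twistedQ k n a b d) x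
  rw [BlowupExitAway.eq_mul_invSelf_pow_of_mul_pow_eq (twistedQ k n a b d) hx]
  exact (hpoly f).mul ((hmemE (Algebra.subset_adjoin (Set.mem_union_right _
    (Set.mem_singleton _)))).pow m)

/-- The even model `E_Q ⊆ L` makes `L` an integral extension (instance form). [folklore] -/
theorem algebra_isIntegral_of_evenModel {L : Type} [CommRing L] [Algebra k L]
    [Algebra (MvPolynomial (Fin n) k) L] [IsScalarTower k (MvPolynomial (Fin n) k) L]
    [IsLocalization.Away (twistedQ k n a b d) L] :
    Algebra.IsIntegral (Algebra.adjoin k (algebraMap (MvPolynomial (Fin n) k) L '' evenGens k n a b c ∪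
      {IsLocalization.Away.invSelf (S := L) (twistedQ k n a b d)})) L :=
  ⟨fun x => isIntegral_of_evenModel k n a b c d x⟩

/-! ## Lying over along the model: radicals in `C ≃ E` are contracted from `L` -/

/-- **Radicals descend along an integral model.** For a subalgebra `E ⊆ L` with `L` integral over `E`,
a ring `C` identified with `E` by `eE`, and a set `S ⊆ C`: if the image of `y ∈ C` in `L` lies in the
radical of the `L`-ideal generated by the images of `S`, then `y ∈ √(S·C)` (lying over: every prime of
`C ⊃ S·C` is contracted from a prime of `L`). [folklore] -/
theorem mem_radical_span_of_model {L C : Type} [CommRing L] [CommRing C] [Algebra k L]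
    (E : Subalgebra k L) [Algebra.IsIntegral E L] (eE : C ≃+* E) (S : Set C) (y : C)
    (hy : ((eE y : E) : L) ∈ (Ideal.span ((fun z => ((eE z : E) : L)) '' S)).radical) :
    y ∈ (Ideal.span S).radical := by
  classical
  rw [Ideal.radical_eq_sInf, Ideal.mem_sInf]
  rintro P ⟨hSP, hP⟩
  haveI := hP
  haveI : (Ideal.map eE P).IsPrime := Ideal.map_isPrime_of_equiv eE
  have hbot : (⊥ : Ideal L).comap (algebraMap E L) ≤ Ideal.map eE P := by
    intro x hx
    rw [Ideal.mem_comap, Ideal.mem_bot] at hx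
    have : x = 0 := Subtype.ext hx
    rw [this]
    exact Ideal.zero_mem _
  obtain ⟨Q', -, hQ'prime, hQ'comap⟩ :=
    Ideal.exists_ideal_over_prime_of_isIntegral (Ideal.map eE P) (⊥ : Ideal L) hbot
  have hSQ' : Ideal.span ((fun z => ((eE z : E) : L)) '' S) ≤ Q' := by
    rw [Ideal.span_le]
    rintro _ ⟨z, hz, rfl⟩
    have hz' : eE z ∈ Ideal.map eE P := Ideal.mem_map_of_mem _ (hSP (Ideal.subset_span hz))
    rw [← hQ'comap, Ideal.mem_comap] at hz'
    exact hz'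
  have hyQ' : ((eE y : E) : L) ∈ Q' := (hQ'prime.radical_le_iff.mpr hSQ') hy
  have hyP' : eE y ∈ Ideal.map eE P := by
    rw [← hQ'comap, Ideal.mem_comap]
    exact hyQ'
  exact Ideal.apply_mem_of_equiv_iff.mp hyP'

/-! ## The ring brick on the chart model -/

/-- **The ring brick `H₁` on the chart model** (see the module docstring): presentation of the
`Σ_T`-invariants of `C ≃ E_Q` by the `½(1,1,1)` cone localised at `Q`, injective, with the radical
identity `√(ψC⁻¹⟨base x_a, base x_b, base x_c, t_j⟩) = J₀`, `J₀` radical with regular affine blow-up.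
[OURS · L1 W4.5c] [folklore; assembly of landed decls] -/
theorem exists_ringBrick_T_model (p : ℕ) (hp : p.Prime) (hp5 : 5 ≤ p) [CharP k p]
    (hab : a ≠ b) (hac : a ≠ c) (had : a ≠ d) (hbc : b ≠ c) (hbd : b ≠ d) (hcd : c ≠ d)
    (τ : MvPolynomial (Fin n) k →ₐ[k] MvPolynomial (Fin n) k)
    (hτc : τ (X c) = X c + X b) (hτ : ∀ i, i ≠ c → τ (X i) = X i)
    {L : Type} [CommRing L] [IsDomain L] [Algebra k L] [Algebra (MvPolynomial (Fin n) k) L]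
    [IsScalarTower k (MvPolynomial (Fin n) k) L] [IsLocalization.Away (twistedQ k n a b d) L]
    (τL : L →ₐ[k] L)
    (hτL : ∀ r, τL (algebraMap (MvPolynomial (Fin n) k) L r) = algebraMap (MvPolynomial (Fin n) k) L (τ r))
    (E : Subalgebra k L)
    (hE : E = Algebra.adjoin k (algebraMap (MvPolynomial (Fin n) k) L '' evenGens k n a b c ∪
      {IsLocalization.Away.invSelf (S := L) (twistedQ k n a b d)}))
    {C : Type} [CommRing C] (base : MvPolynomial (Fin n) k →+* C) (eE : C ≃+* ↥E)
    (hbase : ∀ F, ((eE (base F) : E) : L) = algebraMap (MvPolynomial (Fin n) k) L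
      (twistedChart k n a b c d F))
    (t : {j : Fin 8 // j ≠ 4} → C)
    (ht : ∀ j, base (tPrime k n a b c d) * t j =
      base ((![X a ^ 2, X a * X b ^ 2, X a * X b * X c, X a * X c ^ 3, X b ^ 3, X b ^ 2 * X c ^ 2,
          X b * X c ^ 4, X c ^ 6] : Fin 8 → MvPolynomial (Fin n) k) j.1)) :
    ∃ (R₀ : Type) (_ : CommRing R₀) (J₀ : Ideal R₀) (ψC : R₀ →+* C),
      Function.Injective ψC ∧ (∀ y, y ∈ ψC.range ↔ τL ((eE y : E) : L) = ((eE y : E) : L)) ∧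
      J₀.IsRadical ∧ Scheme.IsRegular (affineBlowup J₀) ∧
      ((Ideal.span (base '' {X a, X b, X c} ∪ Set.range t)).comap ψC).radical = J₀ := by
  classical
  -- constants and memberships
  have h2 : (2 : k) ≠ 0 := two_ne_zero_of_charP k p hp5
  have h3 : (3 : k) ≠ 0 := three_ne_zero_of_charP k p hp5
  have hp2 : p ≠ 2 := by omega
  have hQ : twistedQ k n a b d ∈ invSubalgebraT k n a b c τ :=
    twistedQ_mem_invSubalgebraT k n a b c d τ hab hac hbc had hbd hcd hτ h2
  have hQne : twistedQ k n a b d ≠ 0 := fun h =>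
    twistedQ_not_mem_span_X_abc k n a b c d (h ▸ Ideal.zero_mem _)
  have hQE : twistedQ k n a b d ∈ Algebra.adjoin k (evenGens k n a b c) :=
    twistedQ_mem_adjoin_evenGens k n a b c d hab hac had hbc hbd hcd h2
  have hτQ : τ (twistedQ k n a b d) = twistedQ k n a b d :=
    translate_twistedQ k n a b c d τ hτ hac hbc hcd
  have hinjL : Function.Injective (algebraMap (MvPolynomial (Fin n) k) L) :=
    IsLocalization.injective L (powers_le_nonZeroDivisors_of_noZeroDivisors hQne)
  -- abbreviations
  set ST := invSubalgebraT k n a b c τ with hST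
  set A₁ := Algebra.adjoin k (algebraMap (MvPolynomial (Fin n) k) L '' (ST : Set (MvPolynomial (Fin n) k)) ∪
      {IsLocalization.Away.invSelf (S := L) (twistedQ k n a b d)}) with hA₁def
  -- `A₁ ≤ E`
  have hSTE : ∀ f : MvPolynomial (Fin n) k, f ∈ ST →
      algebraMap (MvPolynomial (Fin n) k) L f ∈ E := by
    intro f hf
    have hf' : f ∈ Algebra.adjoin k (evenGens k n a b c) := ((mem_invSubalgebraT_iff k n a b c τ f).mp hf).1
    have hmap : Subalgebra.map (IsScalarTower.toAlgHom k (MvPolynomial (Fin n) k) L)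
        (Algebra.adjoin k (evenGens k n a b c)) ≤ E := by
      rw [AlgHom.map_adjoin, hE]
      exact Algebra.adjoin_mono Set.subset_union_left
    exact hmap ⟨f, hf', rfl⟩
  have hA₁E : A₁ ≤ E := by
    refine Algebra.adjoin_le ?_
    rintro x (⟨f, hf, rfl⟩ | hx)
    · exact hSTE f hf
    · rw [Set.mem_singleton_iff] at hx
      rw [hx, hE]
      exact Algebra.subset_adjoin (Set.mem_union_right _ (Set.mem_singleton _))
  -- (G1d) the localised cone ring as the subalgebra `A₁`
  obtain ⟨eG, heG⟩ := BlowupExitAway.exists_ringEquiv_away_adjoin (k := k) (S := L)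
    (twistedQ k n a b d) hQne ST hQ
  -- (G1c) the fixed points of `τ_L` in `E` are `A₁`
  have hfix : {f : MvPolynomial (Fin n) k | f ∈ Algebra.adjoin k (evenGens k n a b c) ∧ τ f = f} =
      ↑(Algebra.adjoin k (ST : Set (MvPolynomial (Fin n) k))) := by
    rw [Algebra.adjoin_eq]
    exact (coe_invSubalgebraT k n a b c τ).symm
  have hfixL := BlowupExitAway.fixedPoints_adjoin_away_eq (k := k) (S := L) (twistedQ k n a b d) hQne
    τ hτQ τL hτL (evenGens k n a b c) (ST : Set (MvPolynomial (Fin n) k)) hQE hfix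
  rw [← hE] at hfixL
  -- the presentation `ψC`
  let ψE : Localization.Away (⟨twistedQ k n a b d, hQ⟩ : ST) →+* E :=
    (Subalgebra.inclusion hA₁E).toRingHom.comp eG.toRingHom
  let ψC : Localization.Away (⟨twistedQ k n a b d, hQ⟩ : ST) →+* C := eE.symm.toRingHom.comp ψE
  have hψC_val : ∀ x, ((eE (ψC x) : E) : L) = (eG x : L) := by
    intro x
    change ((eE (eE.symm (ψE x)) : E) : L) = _
    rw [RingEquiv.apply_symm_apply]
    rfl
  have hψC_inj : Function.Injective ψC :=
    eE.symm.injective.comp ((Subalgebra.inclusion_injective hA₁E).comp eG.injective)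
  -- the range of `ψC` = the `τ_L`-fixed elements
  have hrange : ∀ y, y ∈ ψC.range ↔ τL ((eE y : E) : L) = ((eE y : E) : L) := by
    intro y
    constructor
    · rintro ⟨x, rfl⟩
      rw [hψC_val]
      have hmem : (eG x : L) ∈ {x : L | x ∈ E ∧ τL x = x} := by
        rw [hfixL]
        exact (eG x).2
      exact hmem.2
    · intro hy
      have hmem : ((eE y : E) : L) ∈ {x : L | x ∈ E ∧ τL x = x} := ⟨(eE y).2, hy⟩
      rw [hfixL] at hmem
      obtain ⟨x, hx⟩ := eG.surjective ⟨_, hmem⟩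
      refine ⟨x, ?_⟩
      apply eE.injective
      apply Subtype.ext
      rw [hψC_val, hx]
  -- the cone data (part 2) with `S := R₀`, `T := L`
  haveI : IsLocalization.Away ((invSubalgebraT k n a b c τ).val.toRingHom
      (⟨twistedQ k n a b d, hQ⟩ : invSubalgebraT k n a b c τ)) L :=
    ‹IsLocalization.Away (twistedQ k n a b d) L›
  obtain ⟨J₀, hJprime, hJreg, hJcomap⟩ := exists_halfConeVertexIdeal k n a b c d τ hab hac hbc hτc hτ
    p hp hp2 hQ (Localization.Away (⟨twistedQ k n a b d, hQ⟩ : ST)) L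
  -- the localised inclusion `ψL : R₀ → L` is `eG` followed by the inclusion
  set ψL := IsLocalization.Away.map (Localization.Away (⟨twistedQ k n a b d, hQ⟩ : ST)) L
    (invSubalgebraT k n a b c τ).val.toRingHom (⟨twistedQ k n a b d, hQ⟩ : invSubalgebraT k n a b c τ)
    with hψLdef
  have hψL : ∀ x, ψL x = ((eE (ψC x) : E) : L) := by
    intro x
    rw [hψC_val]
    have hext : ψL = (A₁.val.toRingHom.comp eG.toRingHom) := by
      refine IsLocalization.ringHom_ext (Submonoid.powers (⟨twistedQ k n a b d, hQ⟩ : ST)) ?_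
      refine RingHom.ext fun f => ?_
      rw [hψLdef, IsLocalization.Away.map, IsLocalization.map_comp, RingHom.comp_apply,
        RingHom.comp_apply, RingHom.comp_apply]
      exact (heG f).symm
    rw [hext]
    rfl
  -- images of the generators in `L`
  have hs : (X b : MvPolynomial (Fin n) k) ^ 6 ≠ 0 := pow_ne_zero 6 (X_ne_zero b)
  have htL : ∀ j : {j : Fin 8 // j ≠ 4}, ((eE (t j) : E) : L) =
      algebraMap (MvPolynomial (Fin n) k) L (twistedCofactor k n a b c d j.1) *
        IsLocalization.Away.invSelf (S := L) (twistedQ k n a b d) := by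
    intro j
    have h := congrArg (fun z => ((eE z : E) : L)) (ht j)
    simp only [map_mul, Subalgebra.coe_mul] at h
    rw [hbase, hbase, twistedChart_tPrime k n a b c d hab hac had hbc hbd hcd h2 h3,
      twistedChart_I6 k n a b c d hab hac hbc, map_mul, map_mul, mul_assoc] at h
    have h' := mul_left_cancel₀ ((map_ne_zero_iff _ hinjL).mpr hs) h
    -- h' : algebraMap Q * e = algebraMap (q j)
    have hQu : algebraMap (MvPolynomial (Fin n) k) L (twistedQ k n a b d) *
        IsLocalization.Away.invSelf (S := L) (twistedQ k n a b d) = 1 :=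
      IsLocalization.Away.mul_invSelf _
    calc ((eE (t j) : E) : L)
        = (algebraMap (MvPolynomial (Fin n) k) L (twistedQ k n a b d) *
            IsLocalization.Away.invSelf (S := L) (twistedQ k n a b d)) * ((eE (t j) : E) : L) := by
          rw [hQu, one_mul]
      _ = algebraMap (MvPolynomial (Fin n) k) L (twistedCofactor k n a b c d j.1) *
            IsLocalization.Away.invSelf (S := L) (twistedQ k n a b d) := by
          rw [mul_assoc, mul_comm (IsLocalization.Away.invSelf _) , ← mul_assoc, h']
  -- the root-chart ideal and its image in `L`
  set JT := Ideal.span (twistedChart k n a b c d '' {X a, X b, X c} ∪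
      Set.range (fun j : {j : Fin 8 // j ≠ 4} => twistedCofactor k n a b c d j.1)) with hJT
  set JL := JT.map (algebraMap (MvPolynomial (Fin n) k) L) with hJL
  set SC : Set C := base '' {X a, X b, X c} ∪ Set.range t with hSC
  have hJ'eq : Ideal.span ((fun z => ((eE z : E) : L)) '' SC) = JL := by
    apply le_antisymm
    · rw [Ideal.span_le]
      rintro _ ⟨z, hz, rfl⟩
      rcases hz with ⟨x, hx, rfl⟩ | ⟨j, rfl⟩
      · change ((eE (base x) : E) : L) ∈ JL
        rw [hbase]
        exact Ideal.mem_map_of_mem _ (Ideal.subset_span (Or.inl ⟨x, hx, rfl⟩))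
      · change ((eE (t j) : E) : L) ∈ JL
        rw [htL]
        exact Ideal.mul_mem_right _ _ (Ideal.mem_map_of_mem _ (Ideal.subset_span (Or.inr ⟨j, rfl⟩)))
    · rw [hJL, Ideal.map_le_iff_le_comap, hJT, Ideal.span_le]
      rintro _ (⟨x, hx, rfl⟩ | ⟨j, rfl⟩)
      · rw [SetLike.mem_coe, Ideal.mem_comap, ← hbase]
        exact Ideal.subset_span ⟨base x, Or.inl ⟨x, hx, rfl⟩, rfl⟩
      · rw [SetLike.mem_coe, Ideal.mem_comap]
        have hQu : IsLocalization.Away.invSelf (S := L) (twistedQ k n a b d) *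
            algebraMap (MvPolynomial (Fin n) k) L (twistedQ k n a b d) = 1 := by
          rw [mul_comm]; exact IsLocalization.Away.mul_invSelf _
        have e1 : algebraMap (MvPolynomial (Fin n) k) L (twistedCofactor k n a b c d j.1) =
            ((eE (t j) : E) : L) * algebraMap (MvPolynomial (Fin n) k) L (twistedQ k n a b d) := by
          rw [htL, mul_assoc, hQu, mul_one]
        rw [e1]
        exact Ideal.mul_mem_right _ _ (Ideal.subset_span ⟨t j, Or.inr ⟨j, rfl⟩, rfl⟩)
  have hJLrad : JL.radical = (Ideal.span {(X a : MvPolynomial (Fin n) k), X b, X c}).map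
      (algebraMap (MvPolynomial (Fin n) k) L) := by
    rw [hJL, ← IsLocalization.map_radical (Submonoid.powers (twistedQ k n a b d)), hJT,
      radical_span_twistedVertex_eq k n a b c d hab hac hbc]
  -- `𝔞 ↦ JL` under `z ↦ eE z`
  have hSC_JL : ∀ y ∈ Ideal.span SC, ((eE y : E) : L) ∈ JL := by
    intro y hy
    rw [← hJ'eq]
    have : Ideal.map (E.val.toRingHom.comp eE.toRingHom) (Ideal.span SC) =
        Ideal.span ((fun z => ((eE z : E) : L)) '' SC) := by
      rw [Ideal.map_span]; rfl
    rw [← this]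
    exact Ideal.mem_map_of_mem _ hy
  refine ⟨Localization.Away (⟨twistedQ k n a b d, hQ⟩ : ST), inferInstance, J₀, ψC, hψC_inj, hrange,
    hJprime.isRadical, hJreg, ?_⟩
  -- the radical identity
  apply le_antisymm
  · intro x hx
    obtain ⟨m, hm⟩ := hx
    rw [← hJcomap, Ideal.mem_comap]
    have h1 : ψL (x ^ m) ∈ JL := by
      rw [hψL]
      exact hSC_JL _ (Ideal.mem_comap.mp hm)
    rw [map_pow] at h1
    have h2 : ψL x ∈ JL.radical := ⟨m, h1⟩
    rwa [hJLrad] at h2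
  · intro x hx
    rw [← hJcomap, Ideal.mem_comap, ← hJLrad, hψL, ← hJ'eq] at hx
    haveI : Algebra.IsIntegral E L := by
      rw [hE]; exact algebra_isIntegral_of_evenModel k n a b c d (L := L)
    have := mem_radical_span_of_model k E eE SC (ψC x) hx
    rw [← Ideal.comap_radical, Ideal.mem_comap]
    exact this

end Summit.ResolutionOfSingularities.ResolutionOfSingularities.Theorems.WildQuotientResolution.JordanFour

end
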